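import Summits.NavierStokesRegularity.NavierStokesRegularity.Theses.AxisymmetricExtremality
import Literature.Analysis.FluidPDE.SuitableWeakProofs
import HarnessLib

/-!
# `𝒫¹`-null sets contain no spatial segment and have Lebesgue-null time projection —
# crux stmt-NavierStokesRegularity-15453 (`AxisymmetricExtremality.AxisymmetricKatoGlobal`), line registered, support for stub `stub_sereginLogSwirlOrigin`

Support file (`--supports stmt-NavierStokesRegularity-15453`; theorems only, everything proved)
toward the registered stub `stub_sereginLogSwirlOrigin` = the named fact
`Literature.Analysis.FluidPDE.seregin2022_logSwirl_regularAtOrigin` (G. Seregin, J. Math. Fluid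
Mech. 24 (2022), Paper 27 = arXiv:2201.00153, §2).  Step 1 of that proof constructs the cut-off
`η` from the partial regularity of the solution (arXiv p. 5): "Since the 1D parabolic Hausdorff
measure of the set of singular points is equal to zero, there exist at least two regular points
`z₁ = (0, h₁, 0)` and `z₂ = (0, -h₂, 0)` of `v` such that `0 < h₁, h₂ < 1`. … Moreover, one can find
`t₀ ∈ ]-δ², 0[` such that there is no singular point in the set `𝒞̄(r₀) × [t₀, t₀ + δ₀²]`."
Both choices rest on two measure-theoretic facts about `𝒫¹`-null sets `S ⊆ ℝ × F`
(`IsParabolicNull 1 S`, Caffarelli–Kohn–Nirenberg 1982, (2.6); `SuitableWeak.lean`), proved here: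

* `volume_setOf_mem_line_eq_zero_of_isParabolicNull`, `exists_not_mem_line_of_isParabolicNull`
  (registered sub-goal, `F = ℝ³`) — on every spatial line `h ↦ (t, x₀ + h v)`, `‖v‖ = 1`, at a
  fixed time, the parameters `h` with `(t, x₀ + h v) ∈ S` form a Lebesgue-null set; in particular
  every interval `]a, b[` of the line contains a point outside `S` (the regular axis points
  `(0, ±h, 0)`);
* `volume_image_fst_eq_zero_of_isParabolicNull`, `ae_forall_not_mem_of_isParabolicNull`,
  `exists_forall_not_mem_slice_of_isParabolicNull` — the time projection of `S` is Lebesgue-null,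
  so almost every (in particular some) time slice `{t₀} × F` misses `S` entirely (the
  singularity-free slice behind the slab `𝒞̄(r₀) × [t₀, t₀ + δ₀²]`, the slab then coming from the
  relative closedness of the singular set, `closure_singularSet_inter_subset`).

Proofs: a cover of `S` by centred parabolic cylinders `Q*_{rⱼ}(zⱼ)`, `rⱼ < 1`, of cost
`∑ rⱼ < η` (`exists_cover_of_parabolicHausdorffContent_lt`) meets the line in parameter sets of
diameter `≤ 2rⱼ` (`Real.volume_le_diam`) and projects in time onto intervals of length
`2rⱼ² ≤ 2rⱼ`; let `η → 0`.

## References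

* G. Seregin, J. Math. Fluid Mech. 24 (2022), Paper No. 27 = arXiv:2201.00153, §2 Step 1 (arXiv
  p. 5). [`Seregin2022LocalAxisym`]
* L. Caffarelli, R. Kohn, L. Nirenberg, Comm. Pure Appl. Math. 35 (1982), (2.6) and §6.
  [`CaffarelliKohnNirenberg1982`]
-/

noncomputable section

open Set MeasureTheory Filter Topology Function Metric
open scoped ENNReal NNReal
open Literature.Analysis.FluidPDE

-- `<Problem> = <Summit>` duplicates a namespace component by design (lakefile sets the same option).
set_option linter.dupNamespace false

namespace Summit.NavierStokesRegularity.NavierStokesRegularity.Theorems.AxisymmetricKatoGlobal.EulerScaling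

section General

variable {F : Type*} [PseudoMetricSpace F]

/-- The `δ`-content is dominated by the parabolic Hausdorff measure (`𝒫^s = sup_δ 𝒫^s_δ`).
[cite: CaffarelliKohnNirenberg1982, (2.6)] -/
theorem parabolicHausdorffContent_le_parabolicHausdorff (s : ℝ) {δ : ℝ} (hδ : 0 < δ)
    (X : Set (ℝ × F)) : parabolicHausdorffContent s δ X ≤ parabolicHausdorff s X :=
  le_iSup₂ (f := fun (δ : ℝ) (_ : 0 < δ) => parabolicHausdorffContent s δ X) δ hδ

/-- **Cheap covers of a `𝒫¹`-null set**: for every `η > 0`, `S` is covered by centred parabolic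
cylinders `Q*_{rⱼ}(zⱼ)` with `0 ≤ rⱼ < 1` and `∑ⱼ rⱼ < η`. [cite: CaffarelliKohnNirenberg1982, (2.6)] -/
theorem exists_cover_of_isParabolicNull {S : Set (ℝ × F)} (hS : IsParabolicNull 1 S) {η : ℝ≥0∞}
    (hη : 0 < η) :
    ∃ (z : ℕ → ℝ × F) (r : ℕ → ℝ), (∀ j, 0 ≤ r j ∧ r j < 1) ∧
      S ⊆ ⋃ j, parabolicCylinderCentered (r j) (z j) ∧ ∑' j, ENNReal.ofReal (r j) < η := by
  have h0 : parabolicHausdorffContent 1 1 S < η := by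
    calc parabolicHausdorffContent 1 1 S ≤ parabolicHausdorff 1 S :=
          parabolicHausdorffContent_le_parabolicHausdorff 1 one_pos S
      _ = 0 := hS
      _ < η := hη
  obtain ⟨z, r, hr, hcov, hsum⟩ := exists_cover_of_parabolicHausdorffContent_lt h0
  refine ⟨z, r, hr, hcov, ?_⟩
  simpa only [Real.rpow_one] using hsum

/-- **The time projection of a `𝒫¹`-null set is Lebesgue-null** (each `Q*_{rⱼ}(zⱼ)` projects onto
a time interval of length `2rⱼ² ≤ 2rⱼ`). [cite: Seregin2022LocalAxisym, §2 Step 1 (arXiv:2201.00153 p. 5)] -/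
theorem volume_image_fst_eq_zero_of_isParabolicNull {S : Set (ℝ × F)} (hS : IsParabolicNull 1 S) :
    volume (Prod.fst '' S) = 0 := by
  refine le_antisymm (ENNReal.le_of_forall_pos_le_add fun ε hε _ => ?_) bot_le
  rw [zero_add]
  have hε2 : (0 : ℝ≥0∞) < (ε : ℝ≥0∞) / 2 := by
    refine ENNReal.div_pos_iff.2 ⟨?_, ENNReal.ofNat_ne_top⟩
    exact_mod_cast hε.ne'
  obtain ⟨z, r, hr, hcov, hsum⟩ := exists_cover_of_isParabolicNull hS hε2
  have hsub : Prod.fst '' S ⊆ ⋃ j, Ioo ((z j).1 - r j ^ 2) ((z j).1 + r j ^ 2) := by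
    rintro _ ⟨w, hw, rfl⟩
    obtain ⟨j, hj⟩ := mem_iUnion.1 (hcov hw)
    rw [mem_parabolicCylinderCentered] at hj
    exact mem_iUnion.2 ⟨j, hj.1⟩
  have hj : ∀ j, volume (Ioo ((z j).1 - r j ^ 2) ((z j).1 + r j ^ 2)) ≤ 2 * ENNReal.ofReal (r j) := by
    intro j
    rw [Real.volume_Ioo, ← ENNReal.ofReal_ofNat, ← ENNReal.ofReal_mul (by norm_num)]
    refine ENNReal.ofReal_le_ofReal ?_
    nlinarith [(hr j).1, (hr j).2]
  calc volume (Prod.fst '' S)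
      ≤ volume (⋃ j, Ioo ((z j).1 - r j ^ 2) ((z j).1 + r j ^ 2)) := measure_mono hsub
    _ ≤ ∑' j, volume (Ioo ((z j).1 - r j ^ 2) ((z j).1 + r j ^ 2)) := measure_iUnion_le _
    _ ≤ ∑' j, 2 * ENNReal.ofReal (r j) := ENNReal.tsum_le_tsum hj
    _ = 2 * ∑' j, ENNReal.ofReal (r j) := ENNReal.tsum_mul_left
    _ ≤ 2 * ((ε : ℝ≥0∞) / 2) := by gcongr
    _ = ε := by rw [mul_comm, ENNReal.div_mul_cancel two_ne_zero ENNReal.ofNat_ne_top]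

/-- Almost every time slice misses a `𝒫¹`-null set. [cite: Seregin2022LocalAxisym, §2 Step 1 (arXiv:2201.00153 p. 5)] -/
theorem ae_forall_not_mem_of_isParabolicNull {S : Set (ℝ × F)} (hS : IsParabolicNull 1 S) :
    ∀ᵐ t : ℝ, ∀ x : F, (t, x) ∉ S := by
  rw [ae_iff]
  have e : {t : ℝ | ¬ ∀ x : F, (t, x) ∉ S} = Prod.fst '' S := by
    ext t
    simp only [not_forall, not_not, mem_setOf_eq, mem_image, Prod.exists, exists_and_right,
      exists_eq_right]
  rw [e]
  exact volume_image_fst_eq_zero_of_isParabolicNull hS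

/-- **A singularity-free time slice in every time window**: for a `𝒫¹`-null `S` and `a < b` there
is `t₀ ∈ ]a, b[` with `({t₀} × F) ∩ S = ∅`. [cite: Seregin2022LocalAxisym, §2 Step 1 (arXiv:2201.00153 p. 5)] -/
theorem exists_forall_not_mem_slice_of_isParabolicNull {S : Set (ℝ × F)} (hS : IsParabolicNull 1 S)
    {a b : ℝ} (hab : a < b) : ∃ t₀ ∈ Ioo a b, ∀ x : F, (t₀, x) ∉ S := by
  have h := ae_forall_not_mem_of_isParabolicNull hS
  have hpos : 0 < volume (Ioo a b) := by
    rw [Real.volume_Ioo]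
    exact ENNReal.ofReal_pos.2 (by linarith)
  haveI : (ae (volume.restrict (Ioo a b))).NeBot :=
    ae_neBot.2 fun h0 => hpos.ne' (Measure.restrict_eq_zero.1 h0)
  obtain ⟨t₀, ht₀, hgood⟩ := ((ae_restrict_of_ae (s := Ioo a b) h).and
    (ae_restrict_mem measurableSet_Ioo)).exists
  exact ⟨t₀, hgood, ht₀⟩

end General

section Line

variable {F : Type*} [NormedAddCommGroup F] [NormedSpace ℝ F]

/-- **A `𝒫¹`-null set meets every spatial line (at a fixed time) in a Lebesgue-null set of
parameters**: for `‖v‖ = 1`, `volume {h | (t, x₀ + h v) ∈ S} = 0` (each `Q*_{rⱼ}(zⱼ)` meets the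
line in a parameter set of diameter `≤ 2rⱼ`). [cite: Seregin2022LocalAxisym, §2 Step 1 (arXiv:2201.00153 p. 5)] -/
theorem volume_setOf_mem_line_eq_zero_of_isParabolicNull {S : Set (ℝ × F)} (hS : IsParabolicNull 1 S)
    (t : ℝ) (x₀ v : F) (hv : ‖v‖ = 1) :
    volume {h : ℝ | (t, x₀ + h • v) ∈ S} = 0 := by
  refine le_antisymm (ENNReal.le_of_forall_pos_le_add fun ε hε _ => ?_) bot_le
  rw [zero_add]
  have hε2 : (0 : ℝ≥0∞) < (ε : ℝ≥0∞) / 2 := by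
    refine ENNReal.div_pos_iff.2 ⟨?_, ENNReal.ofNat_ne_top⟩
    exact_mod_cast hε.ne'
  obtain ⟨z, r, hr, hcov, hsum⟩ := exists_cover_of_isParabolicNull hS hε2
  set A : ℕ → Set ℝ := fun j => {h : ℝ | (t, x₀ + h • v) ∈ parabolicCylinderCentered (r j) (z j)}
    with hA
  have hsub : {h : ℝ | (t, x₀ + h • v) ∈ S} ⊆ ⋃ j, A j := fun h hh => by
    obtain ⟨j, hj⟩ := mem_iUnion.1 (hcov hh)
    exact mem_iUnion.2 ⟨j, hj⟩
  have hdiam : ∀ j, volume (A j) ≤ 2 * ENNReal.ofReal (r j) := by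
    intro j
    rw [← ENNReal.ofReal_ofNat, ← ENNReal.ofReal_mul (by norm_num)]
    refine (Real.volume_le_diam _).trans (Metric.ediam_le fun h hh h' hh' => ?_)
    rw [edist_dist, Real.dist_eq]
    refine ENNReal.ofReal_le_ofReal ?_
    have h1 : dist (x₀ + h • v) (z j).2 < r j := (mem_parabolicCylinderCentered.1 hh).2
    have h2 : dist (x₀ + h' • v) (z j).2 < r j := (mem_parabolicCylinderCentered.1 hh').2
    have h3 : dist (x₀ + h • v) (x₀ + h' • v) = |h - h'| := by
      rw [dist_eq_norm, add_sub_add_left_eq_sub, ← sub_smul, norm_smul, hv, mul_one,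
        Real.norm_eq_abs]
    have h4 := dist_triangle_right (x₀ + h • v) (x₀ + h' • v) (z j).2
    linarith
  calc volume {h : ℝ | (t, x₀ + h • v) ∈ S}
      ≤ volume (⋃ j, A j) := measure_mono hsub
    _ ≤ ∑' j, volume (A j) := measure_iUnion_le _
    _ ≤ ∑' j, 2 * ENNReal.ofReal (r j) := ENNReal.tsum_le_tsum hdiam
    _ = 2 * ∑' j, ENNReal.ofReal (r j) := ENNReal.tsum_mul_left
    _ ≤ 2 * ((ε : ℝ≥0∞) / 2) := by gcongr
    _ = ε := by rw [mul_comm, ENNReal.div_mul_cancel two_ne_zero ENNReal.ofNat_ne_top]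

/-- On every spatial line at a fixed time, every parameter interval contains a point outside a
`𝒫¹`-null set (general normed space). [cite: Seregin2022LocalAxisym, §2 Step 1 (arXiv:2201.00153 p. 5)] -/
theorem exists_not_mem_line_of_isParabolicNull' {S : Set (ℝ × F)} (hS : IsParabolicNull 1 S)
    (t : ℝ) (x₀ v : F) (hv : ‖v‖ = 1) {a b : ℝ} (hab : a < b) :
    ∃ h ∈ Ioo a b, (t, x₀ + h • v) ∉ S := by
  by_contra hcon
  push Not at hcon
  have hle : volume (Ioo a b) ≤ volume {h : ℝ | (t, x₀ + h • v) ∈ S} :=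
    measure_mono fun h hh => hcon h hh
  rw [volume_setOf_mem_line_eq_zero_of_isParabolicNull hS t x₀ v hv, Real.volume_Ioo,
    nonpos_iff_eq_zero, ENNReal.ofReal_eq_zero] at hle
  linarith

end Line

/-- **Seregin 2022, §2 Step 1, the measure-theoretic choice of the regular axis points** ("Since
the 1D parabolic Hausdorff measure of the set of singular points is equal to zero, there exist at
least two regular points `z₁ = (0, h₁, 0)` and `z₂ = (0, -h₂, 0)` of `v` such that
`0 < h₁, h₂ < 1`"), in the generality actually used: a `𝒫¹`-null set `S ⊆ ℝ × ℝ³`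
(`IsParabolicNull 1 S`, e.g. a singular set by `ckn_partial_regularity_holds`) omits, on every
spatial line `h ↦ (t, x₀ + h v)` (`‖v‖ = 1`, fixed time `t`) and in every parameter window
`]a, b[`, some point. [cite: Seregin2022LocalAxisym, §2 Step 1 (arXiv:2201.00153 p. 5)] -/
theorem exists_not_mem_line_of_isParabolicNull : ∀ (S : Set (ℝ × EuclideanSpace ℝ (Fin 3))), IsParabolicNull 1 S → ∀ (t : ℝ) (x₀ v : EuclideanSpace ℝ (Fin 3)), ‖v‖ = 1 → ∀ (a b : ℝ), a < b → ∃ h ∈ Ioo a b, (t, x₀ + h • v) ∉ S :=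
  fun _ hS t x₀ v hv _ _ hab => exists_not_mem_line_of_isParabolicNull' hS t x₀ v hv hab

end Summit.NavierStokesRegularity.NavierStokesRegularity.Theorems.AxisymmetricKatoGlobal.EulerScaling

end
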